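import Summits.KontsevichZagierPeriods.KontsevichZagierPeriods.Theses.FurushoPentagon
import Literature.NumberTheory.Transcendental.KZCubicalCalculus
import Literature.ModelTheory.ExponentialFields.CylindricalDecompositionProofs
import Literature.ModelTheory.ExponentialFields.SemialgebraicComponents
import Literature.ModelTheory.ExponentialFields.SemialgebraicInterior
import Literature.NumberTheory.Transcendental.SemialgebraicMapsProofs

/-!
# `SectorToKernel`, line `effective-cube-surjection`: analytic + algebraic ⇒ semialgebraic (stub S4)

Stub `stub_semialgebraicOfAlgebraic` of the crux `FurushoPentagon.SectorToKernel`
(stmt-KontsevichZagierPeriods-10813). A function `H : ℝᴹ → ℝ`, continuous (here: analytic near) on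
the closed unit cube `[0,1]ᴹ` and annihilated there by a non-zero polynomial `P ∈ ℚ[x₁, …, x_M][Y]`,
`P(x, H x) = 0` for `x ∈ [0,1]ᴹ`, is `ℚ`-semialgebraic on the cube, i.e. its graph over the cube is
a `ℚ`-semialgebraic subset of `ℝᴹ⁺¹`. Proof (root selection over a cylindrical decomposition,
Bochnak–Coste–Roy 1998, Prop. 8.1.8 with §2.2–2.3; Basu–Pollack–Roy 2006, Thm. 5.16 / Cor. 5.7):
the graph `Γ` lies in the `ℚ`-semialgebraic set `Z = {(x, t) | x ∈ [0,1]ᴹ, P(x, t) = 0}`; take a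
cylindrical decomposition of `ℝᴹ⁺¹` adapted to `Z` (tree:
`IsSemialgebraic.exists_cylindricalDecomposition_holds`, in the fibre form `exists_fibre_eq`). Over
a (connected, Basu–Pollack–Roy Prop. 5.3) base cell `S` meeting `[0,1]ᴹ ∖ B`, where
`B = {x | P(x, ·) ≡ 0}` is the proper algebraic set of points at which every `Y`-coefficient of `P`
vanishes, no band over `S` lies in `Z` (a band is an infinite set of roots of `P(x, ·)`), so the
fibres of `Z` over `S` are finitely many values of the continuous strictly ordered sections
`ξ_{S,j}`, `S ⊆ [0,1]ᴹ`, and the continuous `H|_S`, which picks one of them at each point, picks the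
same one throughout `S` (connectedness); hence `Γ|_S` is the `ℚ`-semialgebraic graph of a section.
Finally `B` has empty interior (`P ≠ 0`), so `[0,1]ᴹ ∖ B` is dense in the cube and `Γ` is the
closure of the finite union of these graphs (`H` is continuous on the compact cube), which is
`ℚ`-semialgebraic (`isSemialgebraic_closure`, Bochnak–Coste–Roy Prop. 2.2.2).

References: J. Bochnak, M. Coste, M.-F. Roy, *Real Algebraic Geometry* (1998), Prop. 2.2.2, §2.3,
Prop. 8.1.8; S. Basu, R. Pollack, M.-F. Roy, *Algorithms in Real Algebraic Geometry* (2006),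
Prop. 5.3, Thm. 5.16, Cor. 5.7.
-/

noncomputable section

namespace Summit.KontsevichZagierPeriods.FurushoPentagon.SectorToKernel

open Set MeasureTheory
open Literature.NumberTheory.Transcendental
open Literature.NumberTheory.Transcendental.KZ hiding cubicalSpan
open Summit.KontsevichZagierPeriods.KontsevichZagierPeriods.Theses.FurushoPentagon

/-- **Root selection on a connected set.** If `H` and finitely many `ξᵢ` are continuous on a
preconnected `S`, the `ξᵢ` take pairwise distinct values at every point of `S`, and `H` agrees at
every point of `S` with some `ξᵢ`, then `H` agrees on all of `S` with the `ξ_{i₀}` it agrees with at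
one point `x₀ ∈ S` (the index of the section through `(x, H x)` is a continuous, hence constant, map
to a discrete space). [Basu–Pollack–Roy 2006, proof of Thm. 5.16; folklore] -/
theorem semialgOfAlg_eqOn_of_isPreconnected {X ι : Type*} [TopologicalSpace X] [Finite ι]
    {S : Set X} (hS : IsPreconnected S) {H : X → ℝ} {ξ : ι → X → ℝ}
    (hH : ContinuousOn H S) (hξ : ∀ i, ContinuousOn (ξ i) S)
    (hinj : ∀ x ∈ S, Function.Injective fun i => ξ i x)
    (hcov : ∀ x ∈ S, ∃ i, H x = ξ i x) {x₀ : X} (hx₀ : x₀ ∈ S) {i₀ : ι} (h₀ : H x₀ = ξ i₀ x₀) :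
    EqOn H (ξ i₀) S := by
  classical
  -- the index of the section through `(x, H x)`
  let idx : X → ι := fun x => if h : ∃ i, H x = ξ i x then h.choose else i₀
  have hidx : ∀ x ∈ S, H x = ξ (idx x) x := fun x hx => by
    simp only [idx, dif_pos (hcov x hx)]
    exact (hcov x hx).choose_spec
  have huniq : ∀ x ∈ S, ∀ i, H x = ξ i x → idx x = i := fun x hx i hi =>
    hinj x hx ((hidx x hx).symm.trans hi)
  letI : TopologicalSpace ι := ⊥
  haveI : DiscreteTopology ι := ⟨rfl⟩
  have hcont : ContinuousOn idx S := by
    intro x₁ hx₁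
    have hev : ∀ᶠ x in nhdsWithin x₁ S, ∀ i, i ≠ idx x₁ → H x - ξ i x ≠ 0 := by
      refine Filter.eventually_all.2 fun i => ?_
      by_cases hi : i = idx x₁
      · exact Filter.Eventually.of_forall fun _ h => (h hi).elim
      · have hne : H x₁ - ξ i x₁ ≠ 0 := fun h =>
          hi (huniq x₁ hx₁ i (sub_eq_zero.1 h)).symm
        exact (((hH x₁ hx₁).sub (hξ i x₁ hx₁)).tendsto.eventually_ne hne).mono
          fun x hx _ => hx
    have hev' : ∀ᶠ x in nhdsWithin x₁ S, idx x = idx x₁ := by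
      filter_upwards [hev, self_mem_nhdsWithin] with x hx hxS
      by_contra hne
      exact hx (idx x) hne (sub_eq_zero.2 (hidx x hxS))
    exact (continuousWithinAt_const (b := idx x₁)).congr_of_eventuallyEq hev' rfl
  intro x hx
  have h1 : idx x = idx x₀ := hS.constant hcont hx hx₀
  have h2 : idx x₀ = i₀ := huniq x₀ hx₀ i₀ h₀
  rw [hidx x hx, h1, h2]

/-- A non-zero polynomial with rational coefficients does not vanish identically on `ℝᴹ`
(`ℝ` is an infinite domain and `ℚ → ℝ` is injective). [folklore] -/
theorem semialgOfAlg_exists_aeval_ne_zero {M : ℕ} {p : MvPolynomial (Fin M) ℚ} (hp : p ≠ 0) :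
    ∃ x : Fin M → ℝ, MvPolynomial.aeval x p ≠ 0 := by
  by_contra h
  push Not at h
  apply hp
  apply MvPolynomial.map_injective (algebraMap ℚ ℝ) (algebraMap ℚ ℝ).injective
  rw [map_zero]
  refine MvPolynomial.funext fun x => ?_
  rw [MvPolynomial.eval_map, map_zero, ← MvPolynomial.aeval_def]
  exact h x

/-- The closed unit cube lies in the closure of its complement to any set with empty interior (the
cube is the closure of its interior, and the complement of a set with empty interior is dense).
[folklore] -/
theorem semialgOfAlg_cube_subset_closure_diff {M : ℕ} {B : Set (Fin M → ℝ)}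
    (hB : interior B = ∅) : KZ.cube M ⊆ closure (KZ.cube M \ B) := by
  have hconv : Convex ℝ (KZ.cube M) := by rw [KZ.cube_eq_Icc]; exact convex_Icc 0 1
  have hint : (interior (KZ.cube M)).Nonempty := by
    refine ⟨fun _ => 1 / 2, interior_maximal KZ.openUnitCube_subset_cube isOpen_openUnitCube ?_⟩
    rw [mem_openUnitCube_iff]
    intro i
    constructor <;> norm_num
  have hdense : Dense Bᶜ := interior_eq_empty_iff_dense_compl.1 hB
  calc KZ.cube M = closure (KZ.cube M) := KZ.isClosed_cube.closure_eq.symm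
    _ = closure (interior (KZ.cube M)) :=
      (hconv.closure_interior_eq_closure_of_nonempty_interior hint).symm
    _ ⊆ closure (closure (interior (KZ.cube M) ∩ Bᶜ)) :=
      closure_mono (hdense.open_subset_closure_inter isOpen_interior)
    _ = closure (interior (KZ.cube M) ∩ Bᶜ) := closure_closure
    _ ⊆ closure (KZ.cube M \ B) := closure_mono fun x hx => ⟨interior_subset hx.1, hx.2⟩

/-- A band `{t | a < t < b}` of the real line with extended-real ends, once non-empty, is infinite
(it is a non-empty open subset of `ℝ`). [folklore] -/
theorem semialgOfAlg_band_infinite {lo up : EReal} {t₀ : ℝ}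
    (h : lo < t₀ ∧ ((t₀ : ℝ) : EReal) < up) :
    {t : ℝ | lo < t ∧ ((t : ℝ) : EReal) < up}.Infinite := by
  have hopen : IsOpen {t : ℝ | lo < t ∧ ((t : ℝ) : EReal) < up} :=
    (isOpen_Ioo (a := lo) (b := up)).preimage continuous_coe_real_ereal
  obtain ⟨ε, hε, hball⟩ := Metric.isOpen_iff.1 hopen t₀ h
  rw [Real.ball_eq_Ioo] at hball
  exact (Set.Ioo_infinite (by linarith)).mono hball

local notation3 "φ " x:arg => MvPolynomial.eval₂Hom (algebraMap ℚ ℝ) x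

open Literature.ModelTheory.ExponentialFields in
/-- **Continuous + algebraic over `ℚ[x]` on the cube ⇒ `ℚ`-semialgebraic graph** (the work horse of
the stub, for a function continuous on the cube whose value at each point of the cube is a root of
the specialisation there of a fixed non-zero `P ∈ ℚ[x₁, …, x_M][Y]`).
[Bochnak–Coste–Roy 1998, Prop. 8.1.8 and §2.3; Basu–Pollack–Roy 2006, Thm. 5.16, Cor. 5.7] -/
theorem semialgOfAlg_isSemialgebraic_graphOver {M : ℕ} {H : (Fin M → ℝ) → ℝ}
    (hHc : ContinuousOn H (KZ.cube M)) {P : Polynomial (MvPolynomial (Fin M) ℚ)} (hP0 : P ≠ 0)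
    (hroot : ∀ x ∈ KZ.cube M, (P.map (φ x)).eval (H x) = 0) :
    IsSemialgebraic ℚ (graphOver (KZ.cube M) H) := by
  classical
  -- the proper algebraic set where the specialisation of `P` vanishes identically
  set B : Set (Fin M → ℝ) := {x | ∀ i, MvPolynomial.aeval x (P.coeff i) = 0} with hBdef
  have hBint : interior B = ∅ := by
    have hi : P.coeff P.natDegree ≠ 0 := Polynomial.leadingCoeff_ne_zero.mpr hP0
    have h1 : B ⊆ {x | MvPolynomial.aeval x (P.coeff P.natDegree) = 0} := fun x hx => hx _
    exact subset_empty_iff.1 ((interior_mono h1).trans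
      (interior_setOf_aeval_eq_zero (P.coeff P.natDegree)
        (semialgOfAlg_exists_aeval_ne_zero hi)).subset)
  have hmapB : ∀ x, P.map (φ x) = 0 → x ∈ B := fun x hx i => by
    have := Polynomial.ext_iff.1 hx i
    rwa [Polynomial.coeff_map, Polynomial.coeff_zero] at this
  -- the algebraic set containing the graph
  set Z : Set (Fin (M + 1) → ℝ) := {z | Fin.init z ∈ KZ.cube M} ∩
    {z | (P.map (φ (Fin.init z))).eval (z (Fin.last M)) = 0} with hZdef
  have hZ : IsSemialgebraic ℚ Z := by
    have h := CylindricalDecomposition.isSemialgebraic_setOf_sign_eval_map (k := ℚ) (n := M) P 0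
    simp only [sign_eq_zero_iff] at h
    exact KZ.isSemialgebraic_cube.setOf_init_mem.inter h
  have hmemZ : ∀ (y : Fin M → ℝ) (t : ℝ), (Fin.snoc y t : Fin (M + 1) → ℝ) ∈ Z ↔
      y ∈ KZ.cube M ∧ (P.map (φ y)).eval t = 0 := fun y t => by
    simp only [hZdef, mem_inter_iff, mem_setOf_eq, Fin.init_snoc, Fin.snoc_last]
  -- cylindrical decomposition adapted to `Z`, fibre form
  obtain ⟨𝒮, l, ξ, h𝒮, hcont, hsa, hmono, -, hfib⟩ :=
    IsSemialgebraic.exists_cylindricalDecomposition.exists_fibre_eq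
      IsSemialgebraic.exists_cylindricalDecomposition_holds hZ
  -- over a cell meeting `cube ∖ B`, `H` is one of the sections
  have hcell : ∀ S (hS : S ∈ 𝒮), ∀ x₀ ∈ S, x₀ ∈ KZ.cube M → x₀ ∉ B →
      S ⊆ KZ.cube M ∧ ∃ j, EqOn H (ξ S j) S := by
    intro S hS x₀ hx₀S hx₀c hx₀B
    obtain ⟨G, Bd, hG, hBd, hfibS⟩ := hfib S hS
    -- no band over `S` lies in `Z`
    have hBd0 : ∀ j, j ∉ Bd := by
      intro j hj
      refine hx₀B (hmapB x₀ (Polynomial.eq_zero_of_infinite_isRoot _ ?_))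
      obtain ⟨t₀, ht₀⟩ :=
        CylindricalDecomposition.exists_mem_band (ξ S) x₀ (hmono S hS x₀ hx₀S) j
      refine (semialgOfAlg_band_infinite ht₀).mono fun t ht => ?_
      have hz : (Fin.snoc x₀ t : Fin (M + 1) → ℝ) ∈ Z :=
        hBd j hj (snoc_mem_bandOver_iff.2 ⟨hx₀S, ht⟩)
      exact ((hmemZ x₀ t).1 hz).2
    -- so the fibres of `Z` over `S` are section values
    have hfib' : ∀ y ∈ S, ∀ t, (Fin.snoc y t : Fin (M + 1) → ℝ) ∈ Z ↔ ∃ j ∈ G, t = ξ S j y := by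
      intro y hy t
      have h := Set.ext_iff.1 (hfibS y hy) t
      simp only [mem_setOf_eq, mem_union, mem_iUnion, mem_singleton_iff, exists_prop] at h
      rw [h]
      constructor
      · rintro (⟨j, hj, rfl⟩ | ⟨j, hj, -⟩)
        · exact ⟨j, hj, rfl⟩
        · exact (hBd0 j hj).elim
      · rintro ⟨j, hj, rfl⟩
        exact Or.inl ⟨j, hj, rfl⟩
    have hx₀Z : (Fin.snoc x₀ (H x₀) : Fin (M + 1) → ℝ) ∈ Z := (hmemZ _ _).2 ⟨hx₀c, hroot x₀ hx₀c⟩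
    obtain ⟨j₀, hj₀G, hj₀⟩ := (hfib' x₀ hx₀S _).1 hx₀Z
    have hSc : S ⊆ KZ.cube M := fun y hy =>
      ((hmemZ _ _).1 (hG j₀ hj₀G (snoc_mem_graphOver_iff.2 ⟨hy, rfl⟩))).1
    refine ⟨hSc, j₀, semialgOfAlg_eqOn_of_isPreconnected (h𝒮.isPreconnected_of_mem S hS)
      (hHc.mono hSc) (hcont S hS) (fun y hy => (hmono S hS y hy).injective) ?_ hx₀S hj₀⟩
    intro y hy
    obtain ⟨j, -, hj⟩ := (hfib' y hy _).1 ((hmemZ _ _).2 ⟨hSc hy, hroot y (hSc hy)⟩)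
    exact ⟨j, hj⟩
  -- the good cells and the visible part of the graph
  set 𝒢 : Finset (Set (Fin M → ℝ)) := 𝒮.filter fun S => (S ∩ (KZ.cube M \ B)).Nonempty with h𝒢def
  have h𝒢mem : ∀ S, S ∈ 𝒢 ↔ S ∈ 𝒮 ∧ (S ∩ (KZ.cube M \ B)).Nonempty := fun S => by
    rw [h𝒢def, Finset.mem_filter]
  have hgood : ∀ S ∈ 𝒢, S ⊆ KZ.cube M ∧ ∃ j, EqOn H (ξ S j) S := fun S hS => by
    obtain ⟨hS𝒮, x₀, hx₀S, hx₀c, hx₀B⟩ := (h𝒢mem S).1 hS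
    exact hcell S hS𝒮 x₀ hx₀S hx₀c hx₀B
  set Γ' : Set (Fin (M + 1) → ℝ) := ⋃ S ∈ 𝒢, graphOver S H with hΓ'def
  have hΓ'sa : IsSemialgebraic ℚ Γ' := by
    refine IsSemialgebraic.biUnion 𝒢 _ fun S hS => ?_
    obtain ⟨-, j, hj⟩ := hgood S hS
    exact isSemialgebraicFunOn_iff_isSemialgebraic_graphOver.1
      ((hsa S ((h𝒢mem S).1 hS).1 j).congr hj.symm)
  have h1 : Γ' ⊆ graphOver (KZ.cube M) H := by
    intro z hz
    rw [hΓ'def, mem_iUnion₂] at hz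
    obtain ⟨S, hS, hzS, hzH⟩ := hz
    exact ⟨(hgood S hS).1 hzS, hzH⟩
  have h2 : graphOver (KZ.cube M \ B) H ⊆ Γ' := by
    rintro z ⟨⟨hzc, hzB⟩, hzH⟩
    obtain ⟨S, ⟨hS, hzS⟩, -⟩ := h𝒮.isPartition.2 (Fin.init z)
    have hS𝒢 : S ∈ 𝒢 := (h𝒢mem S).2 ⟨hS, Fin.init z, hzS, hzc, hzB⟩
    rw [hΓ'def, mem_iUnion₂]
    exact ⟨S, hS𝒢, hzS, hzH⟩
  have h3 : graphOver (KZ.cube M) H ⊆ closure (graphOver (KZ.cube M \ B) H) := by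
    rintro z ⟨hzc, hzH⟩
    have hF : ContinuousWithinAt (fun y : Fin M → ℝ => (Fin.snoc y (H y) : Fin (M + 1) → ℝ))
        (KZ.cube M \ B) (Fin.init z) := by
      refine ContinuousWithinAt.finSnoc continuousWithinAt_id ?_
      exact (hHc _ hzc).mono fun _ hy => hy.1
    have hmem := hF.mem_closure_image (semialgOfAlg_cube_subset_closure_diff hBint hzc)
    have hz : (Fin.snoc (Fin.init z) (H (Fin.init z)) : Fin (M + 1) → ℝ) = z := by
      rw [← hzH, Fin.snoc_init_self]
    rw [hz] at hmem
    refine closure_mono ?_ hmem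
    rintro _ ⟨y, hy, rfl⟩
    exact snoc_mem_graphOver_iff.2 ⟨hy, rfl⟩
  have h4 : IsClosed (graphOver (KZ.cube M) H) := by
    have hF : ContinuousOn (fun y : Fin M → ℝ => (Fin.snoc y (H y) : Fin (M + 1) → ℝ))
        (KZ.cube M) := ContinuousOn.finSnoc continuousOn_id hHc
    have himg : (fun y : Fin M → ℝ => (Fin.snoc y (H y) : Fin (M + 1) → ℝ)) '' KZ.cube M =
        graphOver (KZ.cube M) H := by
      ext z
      constructor
      · rintro ⟨y, hy, rfl⟩
        exact snoc_mem_graphOver_iff.2 ⟨hy, rfl⟩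
      · rintro ⟨hzc, hzH⟩
        exact ⟨Fin.init z, hzc, by beta_reduce; rw [← hzH, Fin.snoc_init_self]⟩
    rw [← himg]
    exact (KZ.isCompact_cube.image_of_continuousOn hF).isClosed
  have heq : graphOver (KZ.cube M) H = closure Γ' :=
    Subset.antisymm (h3.trans (closure_mono h2)) (h4.closure_subset_iff.2 h1)
  rw [heq]
  exact isSemialgebraic_closure hΓ'sa

/-- **S4 (analytic + algebraic ⇒ semialgebraic on the cube).** A function analytic near the closed
unit cube `[0,1]ᴹ` and annihilated on it by a non-zero polynomial `P ∈ ℚ[x₁, …, x_M][Y]` is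
`ℚ`-semialgebraic on the cube (only continuity on the cube is used).
[Bochnak–Coste–Roy 1998, Prop. 8.1.8 and §2.2; Basu–Pollack–Roy 2006, Thm. 5.16, Cor. 5.7] -/
theorem stub_semialgebraicOfAlgebraic :
    ∀ (M : ℕ) (H : (Fin M → ℝ) → ℝ), AnalyticOnNhd ℝ H (KZ.cube M) → (∃ P : Polynomial (MvPolynomial (Fin M) ℚ), P ≠ 0 ∧ ∀ x ∈ KZ.cube M, Polynomial.eval₂ (MvPolynomial.aeval x : MvPolynomial (Fin M) ℚ →ₐ[ℚ] ℝ).toRingHom (H x) P = 0) → IsSemialgebraicFunOn ℚ (KZ.cube M) H := by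
  rintro M H hH ⟨P, hP0, hPH⟩
  have hroot : ∀ x ∈ KZ.cube M, (P.map (φ x)).eval (H x) = 0 := fun x hx => by
    rw [Polynomial.eval_map]
    exact hPH x hx
  exact
    Literature.ModelTheory.ExponentialFields.isSemialgebraicFunOn_iff_isSemialgebraic_graphOver.2
      (semialgOfAlg_isSemialgebraic_graphOver hH.continuousOn hP0 hroot)

end Summit.KontsevichZagierPeriods.FurushoPentagon.SectorToKernel
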